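import Literature.NumberTheory.LFunctions.MertensConjectureDisproofProofs
import HarnessLib

/-!
# Disproof of the Mertens conjecture: the numerical input, split into its two published parts

Topic `NumberTheory/LFunctions` (summit `RiemannHypothesis`, inventory id rh.S22:
`Literature.NumberTheory.LFunctions.not_mertens_conjecture`, `Literature.NumberTheory.LFunctions.odlyzko_te_riele_limsup`, `Literature.NumberTheory.LFunctions.odlyzko_te_riele_liminf`
of `RHWave0.lean`).

After `MertensConjectureDisproof.lean` (architecture and the three named facts) and
`MertensConjectureDisproofProofs.lean` (discharge of the kernel theorem
`Literature.NumberTheory.LFunctions.OdlyzkoTeRiele1985_kernelTheorem_holds` and of the admissibility of the Jurkat–Peyerimhoff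
kernel `Literature.NumberTheory.LFunctions.jurkatPeyerimhoffKernel_admissible_holds`), the refutation of the Mertens conjecture
rests on the single named fact `Literature.NumberTheory.LFunctions.OdlyzkoTeRiele1985_numerics`
(`Literature.NumberTheory.LFunctions.not_mertens_conjecture_of_numerics`). That fact is the conjunction of two *different*
published machine computations:

* **(B)** the zeros `ρ = β + iγ` of `ζ` with `0 < β < 1`, `|γ| < T` are simple and on the critical
  line — for the paper's `T = γ₂₀₀₀ = 2515.286…` this is covered by Brent's 1979 verification of
  the first 75 000 000 zeros (`Literature.NumberTheory.LFunctions.Brent1979_zerosSimpleOnLine`, vendored in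
  `MertensConjectureDisproofProofs.lean`; the paper itself cites the verification for the first
  `1.5 × 10⁹` zeros, ref. [26], p. 139);
* **(N)** the two values of the finite trigonometric sum `h_K(y)` in Table 3, p. 155 (lines 15 and
  21), computed from the first 2000 zeros known to 100 decimal digits (§4.2) at two values of `y`
  of size `≈ 10⁶⁴` found by lattice basis reduction (§3, §4.3).

This file vendors (N) on its own as the named fact `Literature.NumberTheory.LFunctions.OdlyzkoTeRiele1985_table3` and proves
the assembly: (B) ∧ (N) ⟹ `OdlyzkoTeRiele1985_numerics` ⟹ rh.S22. Thereby the one input of the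
disproof that is not proved in the tree is isolated in the exact form a certified computation
would have to deliver: an enclosure of `Re h_K(y)` at one `y` for the Jurkat–Peyerimhoff weight
`k(t) = g(t/T)` and the zeros below a height `T ∈ (2515, 2516)`.

## Main declarations (namespace `Literature.RH`)

* `OdlyzkoTeRiele1985_table3` — NAMED FACT (N).
* `OdlyzkoTeRiele1985_numerics_of_table3` — (B) ∧ (N) give `OdlyzkoTeRiele1985_numerics`.
* `odlyzko_te_riele_limsup_of_table3`, `odlyzko_te_riele_liminf_of_table3`,
  `not_mertens_conjecture_of_table3` — rh.S22 from (B) ∧ (N); everything else is proved.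

## References

* A. M. Odlyzko, H. J. J. te Riele, *Disproof of the Mertens conjecture*, J. reine angew. Math.
  357 (1985) 138–160: (4.1) p. 150 (the weight `k(t) = g(t/T)`, `T = γ₂₀₀₀ = 2515.286…`), §4.2
  (the first 2000 zeros to 100 digits), §4.3 Table 3 p. 155 (lines 15 and 21), §1 p. 139.
* R. P. Brent, *On the zeros of the Riemann zeta function in the critical strip*, Math. Comp. 33
  (1979) 1361–1372 (first 75 000 000 zeros simple and on the line).
-/

noncomputable section

open Complex

namespace Literature.NumberTheory.LFunctions

/-- NAMED FACT — **Table 3 of Odlyzko–te Riele** (p. 155), the numerical heart of the disproof. With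
the weight `k(t) = g(t/T)` of (4.1), `g` the Jurkat–Peyerimhoff kernel
(`jurkatPeyerimhoffKernel`) and `T = γ₂₀₀₀ = 2515.286…` the ordinate of the 2000-th zero of `ζ`
(p. 150), the finite sum `h_K(y) = Σ_{|γ| < T} k(γ) e^{iγy}/(ρζ'(ρ))` (`inghamSum`) takes the value
`h_K(y) = 1.061545` (line 15) at
`y = -14045289680592998046790361630399781127400591999789738039965960762.521505`
and the value `h_K(y) = -1.009749` (line 21) at
`y = 32097025772922655869740000186211307099797144540349062682805321651.697419`;
"Consequently, the Mertens conjecture is false" (p. 155). The values were computed from the first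
2000 zeros known to at least 100 decimal digits (§4.2, with a posteriori error control (4.7)).
Recorded existentially in `y`, with the paper's headline bounds `1.06` and `-1.009` (§1, p. 139),
and with `T` located in `(2515, 2516)` as printed (`T = 2515.286…`, p. 150) rather than defined as
`γ₂₀₀₀`. A certified multiprecision
computation, not reproduced in the tree; users take `(h : OdlyzkoTeRiele1985_table3)`. Together
with Brent's zero verification it yields `OdlyzkoTeRiele1985_numerics`
(`OdlyzkoTeRiele1985_numerics_of_table3`). [cite: OdlyzkoTeRiele1985, §4.3 Table 3 (lines 15, 21) p. 155] [cite: OdlyzkoTeRiele1985, (4.1) p. 150] -/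
def OdlyzkoTeRiele1985_table3 : Prop :=
  ∃ T : ℝ, 2515 < T ∧ T < 2516 ∧
    (∃ y : ℝ, (1.06 : ℝ) <
      (inghamSum (fun t : ℝ => (jurkatPeyerimhoffKernel (t / T) : ℂ)) T y).re) ∧
    (∃ y : ℝ,
      (inghamSum (fun t : ℝ => (jurkatPeyerimhoffKernel (t / T) : ℂ)) T y).re < -1.009)

/-- **(B) ∧ (N) ⟹ the numerics fact.** Brent's verification (zeros with `0 < γ < 32 585 736.4`
simple and on the line) supplies the zero clause of `OdlyzkoTeRiele1985_numerics` at any height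
`T < 2516` (`zetaZeros_simple_onLine_of_Brent1979`), and Table 3 supplies the two values of
`h_K`. [cite: OdlyzkoTeRiele1985, p. 139 (ref. [26]) and §4.3 p. 155] [cite: Brent1979, Abstract and §4] -/
theorem OdlyzkoTeRiele1985_numerics_of_table3 (hB : Brent1979_zerosSimpleOnLine)
    (h : OdlyzkoTeRiele1985_table3) : OdlyzkoTeRiele1985_numerics := by
  obtain ⟨T, hT₁, hT₂, h₁, h₂⟩ := h
  exact ⟨T, by linarith, zetaZeros_simple_onLine_of_Brent1979 hB (by linarith), h₁, h₂⟩

/-- **rh.S22, positive side, from the two published computations**: Brent 1979 (zeros) and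
Odlyzko–te Riele Table 3 line 15 give `limsup M(x)x^{-1/2} > 1.06`; the kernel theorem and the
admissibility of the Jurkat–Peyerimhoff kernel are proved in the tree. [cite: OdlyzkoTeRiele1985, §1 p. 139 and §4.3 p. 155] -/
theorem odlyzko_te_riele_limsup_of_table3 (hB : Brent1979_zerosSimpleOnLine)
    (h : OdlyzkoTeRiele1985_table3) : odlyzko_te_riele_limsup :=
  odlyzko_te_riele_limsup_of_numerics (OdlyzkoTeRiele1985_numerics_of_table3 hB h)

/-- **rh.S22, negative side, from the two published computations**: Brent 1979 and Table 3
line 21 give `liminf M(x)x^{-1/2} < -1.009`. [cite: OdlyzkoTeRiele1985, §1 p. 139 and §4.3 p. 155] -/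
theorem odlyzko_te_riele_liminf_of_table3 (hB : Brent1979_zerosSimpleOnLine)
    (h : OdlyzkoTeRiele1985_table3) : odlyzko_te_riele_liminf :=
  odlyzko_te_riele_liminf_of_numerics (OdlyzkoTeRiele1985_numerics_of_table3 hB h)

/-- **The Mertens conjecture is false, from the two published computations** (Brent 1979 for the
zeros below `T`, Odlyzko–te Riele Table 3 for `h_K`): the remaining steps of the printed proof —
the kernel theorem of Ingham and Jurkat–Peyerimhoff (p. 144), the Jurkat–Peyerimhoff kernel
(4.1), and the passage from `limsup > 1.06` to a failure of `|M(x)| < √x` — are theorems of the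
tree. [cite: OdlyzkoTeRiele1985, p. 155] -/
theorem not_mertens_conjecture_of_table3 (hB : Brent1979_zerosSimpleOnLine)
    (h : OdlyzkoTeRiele1985_table3) : not_mertens_conjecture :=
  not_mertens_conjecture_of_numerics (OdlyzkoTeRiele1985_numerics_of_table3 hB h)

end Literature.NumberTheory.LFunctions

end
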